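import Mathlib
import Literature.Algebra.Polynomial.DescartesRootIsolation

/-!
# Line `negsquares` — memo PART II §25: the VIOLATOR SKELETON in kernel (lemmas L1–L3, the endpoint identity, the AP monotonicity bracket, the Bernstein carrier)

Ideator seat `val-idea-6`, generation 15 (v1.0 → v1.1 with §8, 2026-08-29).  Crux `MatrixDescartes` (stmt-18050) is NOT touched; `VP ≠ VNP` is not moved; NO `sorry`;
nothing is registered.  Companions: `Lines/negsquares-kink-II.md` §25 (paper), `Lines/negsquares_Hstart_offAP.lean` (the exact off-AP design).

DICTIONARY (§25.0).  Two letters; at a point x: tilted means `m₀, m₁`, tilted variances `v₀, v₁ ≥ 0`, `ρ = q₀/q₁ > 0`, `d = m₀ − m₁`;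
`ψ = d² − v₀(1 + 1/ρ) − v₁(1 + ρ)` and ISLAND POINT ⟺ `ψ > 0`.  Below `η₂` both means lie in `[0, a]`, `a = d₂` (after `d₁ = 0`), and no atom of the
support lies strictly between `0` and `a`.  Everything below is elementary real algebra; the analytic facts it is combined with on paper (means are
non-decreasing in x; `sign H″ = sign ψ`) are NOT formalised here and appear only as hypotheses (`Monotone m₀`, …).

CONTENTS.  §1 L1: `island_sep` — an island point has `√v₀ + √v₁ < |m₀ − m₁|` (AM–GM in ρ), and `psi_mul_rho` (ψ·ρ is a quadratic in ρ: the balance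
window).  §2 L2: `secondMoment_ge` — if every atom `x` satisfies `x(x − a) ≥ 0` then `Σ p x² ≥ a Σ p x`, hence `v ≥ m(a − m)`.  §3 the HALF-LINE LEMMA
(trig-free form of the angular separation `|θ₀ − θ₁| > π/4`): at an island point below η₂ the leader's mean is `> a/2` and the follower's `< a/2`
(`leader_gt_half`, `follower_lt_half`), and L3 `common_leader`: with non-decreasing means, a leader-0 island point cannot be followed by a leader-1
island point.  §4 `endpoint_identity`: for a law on three atoms `0, a, b` whose mean is `a`, the third central moment is `(b − 2a)`× the variance —
the mechanism behind the off-AP counterexample (support (0,a,4a) critical).  §5 `snr_num_identity` / `snr_bracket_pos`: the algebra of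
«SNR² = s(κ+2s)²/(κ+4s+κs²) is increasing on 0 < s < 1» for an AP letter `1 + κs + s²` (formal derivative numerator = `(κ+2s)·[κ²(1−s²) + κ(2s³+6s) + 16s²] > 0`).
§6 the Bernstein layer of §25.8: `T_identity` (ψ·P³Q³ is the polynomial T), `T_balance` (T = a₁²(−a₁²B + a₁Δ − Γ)), `bern0_neg`, `bern1_neg`
(the first two Bernstein coefficients of T/u on [0,η₂] are negative on AP(2,3)).  §7 the Descartes edge: `zeros_below_eta2_le_of_var`, a one-line reading of the
Literature fact `countP_roots_Ioo_le_signVariations_dtest` (BPR Prop. 10.32) — the only non-Mathlib import of this file.  §8 the binomial face ν = 0: `T_face`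
(T = u·F, F of degree 8 with three parameters) and its two dust corners `T_corner_const` (one variation), `T_corner_mid` + `Tmid_one_neg` (two variations, one zero
in (0,1)).
-/

set_option linter.dupNamespace false

namespace Summit.ValiantsHypothesis.ValiantsHypothesis.Cruxes.MatrixDescartes.NegSquaresViolator

open Finset BigOperators

/-! ## §1  L1 — separation inside an island, and the balance window -/

/-- ψ of §25.0. -/
noncomputable def psi (d v0 v1 ρ : ℝ) : ℝ := d ^ 2 - v0 * (1 + 1 / ρ) - v1 * (1 + ρ)

/-- L1 (window form): `ψ·ρ = −(v₁ρ² − Dρ + v₀)` with `D = d² − v₀ − v₁`; so for ρ > 0, ψ > 0 iff ρ lies strictly between the roots of the quadratic. -/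
theorem psi_mul_rho (d v0 v1 ρ : ℝ) (hρ : ρ ≠ 0) :
    psi d v0 v1 ρ * ρ = -(v1 * ρ ^ 2 - (d ^ 2 - v0 - v1) * ρ + v0) := by
  unfold psi
  field_simp
  ring

/-- L1 (separation): at an island point the two tilted laws are 1σ-separated: `√v₀ + √v₁ < |m₀ − m₁|`. -/
theorem island_sep {d v0 v1 ρ : ℝ} (hρ : 0 < ρ) (h0 : 0 ≤ v0) (h1 : 0 ≤ v1)
    (hψ : 0 < psi d v0 v1 ρ) : Real.sqrt v0 + Real.sqrt v1 < |d| := by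
  set a := Real.sqrt v0 with ha
  set b := Real.sqrt v1 with hb
  have ha0 : 0 ≤ a := Real.sqrt_nonneg _
  have hb0 : 0 ≤ b := Real.sqrt_nonneg _
  have ha2 : a ^ 2 = v0 := Real.sq_sqrt h0
  have hb2 : b ^ 2 = v1 := Real.sq_sqrt h1
  -- multiply ψ > 0 by ρ > 0
  have hψρ : 0 < d ^ 2 * ρ - v0 * (ρ + 1) - v1 * (1 + ρ) * ρ := by
    have h1 := mul_pos hψ hρ
    have e := psi_mul_rho d v0 v1 ρ hρ.ne'
    nlinarith [h1, e]
  rw [← ha2, ← hb2] at hψρ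
  have hsq : (a + b) ^ 2 < d ^ 2 := by
    by_contra hneg
    push Not at hneg
    have hmul : d ^ 2 * ρ ≤ (a + b) ^ 2 * ρ := mul_le_mul_of_nonneg_right hneg hρ.le
    nlinarith [sq_nonneg (a - b * ρ), hmul, hψρ]
  have := (sq_lt_sq.mp hsq)
  rwa [abs_of_nonneg (by positivity : 0 ≤ a + b)] at this

/-! ## §2  L2 — the nearest-atom bound on the variance -/

/-- L2: if every atom `x i` (with weight `p i ≥ 0`) satisfies `x(x − a) ≥ 0` — no atom strictly between 0 and a — then `Σ p x² ≥ a·Σ p x`. -/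
theorem secondMoment_ge {ι : Type*} (s : Finset ι) (p x : ι → ℝ) (a : ℝ)
    (hp : ∀ i ∈ s, 0 ≤ p i) (hx : ∀ i ∈ s, 0 ≤ x i * (x i - a)) :
    a * ∑ i ∈ s, p i * x i ≤ ∑ i ∈ s, p i * x i ^ 2 := by
  have : 0 ≤ ∑ i ∈ s, p i * (x i * (x i - a)) :=
    Finset.sum_nonneg (fun i hi => mul_nonneg (hp i hi) (hx i hi))
  have e : ∑ i ∈ s, p i * (x i * (x i - a)) = ∑ i ∈ s, p i * x i ^ 2 - a * ∑ i ∈ s, p i * x i := by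
    rw [Finset.mul_sum, ← Finset.sum_sub_distrib]
    refine Finset.sum_congr rfl (fun i _ => by ring)
  linarith [e ▸ this]

/-- L2, variance form: with `m = Σ p x`, `e₂ = Σ p x²` and `e₂ ≥ a m`, the variance `e₂ − m²` is at least `m(a − m)`. -/
theorem variance_ge {m e2 a : ℝ} (h : a * m ≤ e2) : m * (a - m) ≤ e2 - m ^ 2 := by nlinarith

/-! ## §3  The half-line lemma and L3 (common leader) -/

/-- separation below η₂ in nearest-atom form: the leader is letter 0. -/
def SepBelow (a m0 m1 : ℝ) : Prop :=
  Real.sqrt (m0 * (a - m0)) + Real.sqrt (m1 * (a - m1)) < m0 - m1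

/-- from L1 + L2: an island point below η₂ (means in `[0,a]`, variances at least the nearest-atom bounds) with leader 0 satisfies `SepBelow a m₀ m₁`. -/
theorem sepBelow_of_island {a m0 m1 v0 v1 ρ : ℝ} (hρ : 0 < ρ)
    (hm0 : 0 ≤ m0) (hm0a : m0 ≤ a) (hm1 : 0 ≤ m1) (hm1a : m1 ≤ a)
    (hv0 : m0 * (a - m0) ≤ v0) (hv1 : m1 * (a - m1) ≤ v1)
    (hlead : m1 ≤ m0) (hψ : 0 < psi (m0 - m1) v0 v1 ρ) : SepBelow a m0 m1 := by
  have hb0 : 0 ≤ m0 * (a - m0) := mul_nonneg hm0 (by linarith)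
  have hb1 : 0 ≤ m1 * (a - m1) := mul_nonneg hm1 (by linarith)
  have h0 : 0 ≤ v0 := le_trans hb0 hv0
  have h1 : 0 ≤ v1 := le_trans hb1 hv1
  have hsep := island_sep hρ h0 h1 hψ
  rw [abs_of_nonneg (by linarith : 0 ≤ m0 - m1)] at hsep
  have e0 : Real.sqrt (m0 * (a - m0)) ≤ Real.sqrt v0 := Real.sqrt_le_sqrt hv0
  have e1 : Real.sqrt (m1 * (a - m1)) ≤ Real.sqrt v1 := Real.sqrt_le_sqrt hv1
  unfold SepBelow
  linarith

/-- HALF-LINE LEMMA (leader side): `SepBelow a m₀ m₁` with `0 ≤ m₀, m₁` forces `a/2 < m₀`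
(trig form: θ₀ − θ₁ > π/4 ⇒ θ₀ > π/4).  Proof: if `m₀ ≤ a/2` then `√(m₀(a−m₀)) ≥ m₀`, so `m₀ − m₁ > m₀`, i.e. `m₁ < 0`. -/
theorem leader_gt_half {a m0 m1 : ℝ} (hm0 : 0 ≤ m0) (hm1 : 0 ≤ m1)
    (h : SepBelow a m0 m1) : a / 2 < m0 := by
  by_contra hle
  push Not at hle
  have hsq : m0 ≤ Real.sqrt (m0 * (a - m0)) :=
    calc m0 = Real.sqrt (m0 ^ 2) := (Real.sqrt_sq hm0).symm
      _ ≤ Real.sqrt (m0 * (a - m0)) := Real.sqrt_le_sqrt (by nlinarith)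
  have h1 : 0 ≤ Real.sqrt (m1 * (a - m1)) := Real.sqrt_nonneg _
  unfold SepBelow at h
  linarith

/-- HALF-LINE LEMMA (follower side): `SepBelow a m₀ m₁` with `m₀, m₁ ≤ a` forces `m₁ < a/2` (trig form: θ₁ < π/4).  Proof: if `m₁ ≥ a/2` then
`√(m₁(a−m₁)) ≥ a − m₁`, so `m₀ − m₁ > a − m₁`, i.e. `m₀ > a`. -/
theorem follower_lt_half {a m0 m1 : ℝ} (hm0a : m0 ≤ a) (hm1a : m1 ≤ a)
    (h : SepBelow a m0 m1) : m1 < a / 2 := by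
  by_contra hle
  push Not at hle
  have hsq : a - m1 ≤ Real.sqrt (m1 * (a - m1)) :=
    calc a - m1 = Real.sqrt ((a - m1) ^ 2) := (Real.sqrt_sq (by linarith)).symm
      _ ≤ Real.sqrt (m1 * (a - m1)) := Real.sqrt_le_sqrt (by nlinarith)
  have h0 : 0 ≤ Real.sqrt (m0 * (a - m0)) := Real.sqrt_nonneg _
  unfold SepBelow at h
  linarith

/-- L3 — COMMON LEADER (every K, every support).  If the tilted mean `m₀` is a non-decreasing function of x, then a leader-0 island point `x`
(with `m₀(x), m₁(x) ≥ 0`) cannot be followed by a leader-1 island point `x' ≥ x` (with `m₀(x'), m₁(x') ≤ a`) — apply with the letters swapped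
for the other order.  Only the monotonicity of the FIRST leader's mean and four of the eight box constraints are used.  On paper the hypotheses
`SepBelow` come from `sepBelow_of_island` (L1 + L2). -/
theorem common_leader {a : ℝ} {m0 m1 : ℝ → ℝ} (hmono0 : Monotone m0)
    {x x' : ℝ} (hxx' : x ≤ x')
    (hr0 : 0 ≤ m0 x) (hr1 : 0 ≤ m1 x) (hr1a' : m1 x' ≤ a) (hr0a' : m0 x' ≤ a)
    (hx : SepBelow a (m0 x) (m1 x)) (hx' : SepBelow a (m1 x') (m0 x')) : False := by
  have h1 : a / 2 < m0 x := leader_gt_half hr0 hr1 hx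
  have h2 : m0 x' < a / 2 := follower_lt_half hr1a' hr0a' hx'
  have h3 : m0 x ≤ m0 x' := hmono0 hxx'
  linarith

/-! ## §4  The endpoint identity (off-AP mechanism, §25.6) -/

/-- ENDPOINT IDENTITY.  A law on the three atoms `0, a, b` with weights `p₀, p_a, p_b` has mean `a` iff `a·p₀ = (b − a)·p_b` (given total mass 1;
we take this as the hypothesis).  Then its third central moment `−p₀a³ + p_b(b−a)³` equals `(b − 2a)` × its variance `p₀a² + p_b(b−a)²`.
Consequence on paper: at η₂, `(log SNR₀²)′ = 2v₀/a − (b − 2a)`, so the support `(0, a, 4a)` is exactly critical and `2a < b < 4a` opens the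
window in which the start form H⁺(2) fails. -/
theorem endpoint_identity {a b p0 pb : ℝ} (hmean : a * p0 = (b - a) * pb) :
    -p0 * a ^ 3 + pb * (b - a) ^ 3 = (b - 2 * a) * (p0 * a ^ 2 + pb * (b - a) ^ 2) := by
  linear_combination (-(a * (b - a))) * hmean

/-- the mean condition itself: total mass 1 and mean `a` give `a·p₀ = (b − a)·p_b`. -/
theorem mean_condition {a b p0 pa pb : ℝ} (hmass : p0 + pa + pb = 1) (hmean : pa * a + pb * b = a) :
    a * p0 = (b - a) * pb := by
  have : a * (p0 + pa + pb) = a := by rw [hmass, mul_one]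
  linarith [this]

/-- the trichotomy used in §25.6: with `c₃ = (b − 2a)v`, `v > 0`, `a > 0`, the log-derivative `2v/a − c₃/v` of SNR² at η₂ equals `2v/a − (b − 2a)`;
in particular for `b = 4a` it is positive iff `v > a²` iff SNR² = a²/v < 1 — level and slope conditions coincide. -/
theorem snr_logderiv_at_eta2 {a b v c3 : ℝ} (hv : v ≠ 0) (hc : c3 = (b - 2 * a) * v) :
    2 * v / a - c3 / v = 2 * v / a - (b - 2 * a) := by
  rw [hc]; field_simp

theorem critical_support {a v : ℝ} (ha : 0 < a) :
    (0 < 2 * v / a - (4 * a - 2 * a)) ↔ a ^ 2 < v := by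
  constructor
  · intro h
    have : (4 * a - 2 * a) < 2 * v / a := by linarith
    rw [lt_div_iff₀ ha] at this
    nlinarith
  · intro h
    have : (4 * a - 2 * a) * a < 2 * v := by nlinarith
    have := (lt_div_iff₀ ha).mpr this
    linarith

/-! ## §5  AP letters: the SNR monotonicity bracket (§25.4 Proposition) -/

/-- For the AP letter `1 + κs + s²`: `SNR² = N/Dn` with `N = s(κ+2s)²`, `Dn = κ + 4s + κs²`.  With the formal derivatives
`N' = (κ+2s)(κ+6s)` (= d/ds of `s(κ+2s)²`), `Dn' = 4 + 2κs` one has `N'·Dn − N·Dn' = (κ+2s)·[κ²(1−s²) + κ(2s³+6s) + 16s²]`,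
the numerator of `d(SNR²)/ds`. -/
theorem snr_num_identity (κ s : ℝ) :
    ((κ + 2 * s) * (κ + 6 * s)) * (κ + 4 * s + κ * s ^ 2) - (s * (κ + 2 * s) ^ 2) * (4 + 2 * κ * s)
      = (κ + 2 * s) * (κ ^ 2 * (1 - s ^ 2) + κ * (2 * s ^ 3 + 6 * s) + 16 * s ^ 2) := by
  ring

/-- the bracket is positive for `κ > 0`, `0 < s < 1` — so SNR² is strictly increasing there (the Proposition of §25.4). -/
theorem snr_bracket_pos {κ s : ℝ} (hκ : 0 < κ) (hs : 0 < s) (hs1 : s < 1) :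
    0 < (κ + 2 * s) * (κ ^ 2 * (1 - s ^ 2) + κ * (2 * s ^ 3 + 6 * s) + 16 * s ^ 2) := by
  have h1 : 0 < 1 - s ^ 2 := by nlinarith
  positivity


/-! ## §6  The Bernstein layer (§25.8): the polynomial carrier `T = ψ·P³Q³` and its balance decomposition

With `m₀ = P₁/P`, `v₀ = P₂/P − m₀²` (P, P₁ = θP, P₂ = θ²P the letter and its Euler derivatives at the point), similarly for Q, and `ρ = P/Q`,
the sign of ψ is carried by the polynomial `T := PQ(P₁Q − PQ₁)² − (PP₂ − P₁²)(P+Q)Q³ − (QQ₂ − Q₁²)(P+Q)P³` (`T_identity`), and with the balance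
made explicit (`Q = a₁Q̂`) `T = a₁²·(−a₁²·B + a₁·Δ − Γ)` with `B = Q̂⁴(PP₂ − P₁²)`, `Γ = P⁴(Q̂Q̂₂ − Q̂₁²)` (non-negative power coefficients) and
`Δ = PQ̂·[(P₁Q̂ − PQ̂₁)² − Q̂²(PP₂ − P₁²) − P²(Q̂Q̂₂ − Q̂₁²)]` (`T_balance`) — L1's window, now coefficientwise.  On AP(2,3) the first two Bernstein
coefficients of `T/u` on `[0, η₂]` are `a₁²·b₀`, `a₁²·b₁` with `b₀ = −(κ₀a₁ + μ)(a₁ + 1)` and `b₁` as in `bern1_neg` (μ = κ₁λ, ν = λ²): both negative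
(`bern0_neg`, `bern1_neg`).  The Descartes–Bernstein step (zeros in (0,1) ≤ sign variations of the Bernstein coefficients) is classical and not formalised. -/

theorem T_identity {P P1 P2 Q Q1 Q2 : ℝ} (hP : P ≠ 0) (hQ : Q ≠ 0) :
    psi (P1 / P - Q1 / Q) (P2 / P - (P1 / P) ^ 2) (Q2 / Q - (Q1 / Q) ^ 2) (P / Q) * (P ^ 3 * Q ^ 3)
      = P * Q * (P1 * Q - P * Q1) ^ 2 - (P * P2 - P1 ^ 2) * (P + Q) * Q ^ 3 - (Q * Q2 - Q1 ^ 2) * (P + Q) * P ^ 3 := by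
  unfold psi
  field_simp
  ring

theorem T_balance (P P1 P2 Qh Qh1 Qh2 a1 : ℝ) :
    P * (a1 * Qh) * (P1 * (a1 * Qh) - P * (a1 * Qh1)) ^ 2 - (P * P2 - P1 ^ 2) * (P + a1 * Qh) * (a1 * Qh) ^ 3
        - ((a1 * Qh) * (a1 * Qh2) - (a1 * Qh1) ^ 2) * (P + a1 * Qh) * P ^ 3
      = a1 ^ 2 * ( -(a1 ^ 2) * (Qh ^ 4 * (P * P2 - P1 ^ 2))
          + a1 * (P * Qh * ((P1 * Qh - P * Qh1) ^ 2 - Qh ^ 2 * (P * P2 - P1 ^ 2) - P ^ 2 * (Qh * Qh2 - Qh1 ^ 2)))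
          - P ^ 4 * (Qh * Qh2 - Qh1 ^ 2) ) := by
  ring

/-- AP(2,3): the 0-th Bernstein coefficient of `T/(a₁²u)` on [0,1] is `−κ₀a₁² − (κ₀+μ)a₁ − μ = −(κ₀a₁ + μ)(a₁ + 1) < 0`. -/
theorem bern0_neg {κ0 μ a1 : ℝ} (hκ : 0 < κ0) (hμ : 0 < μ) (ha : 0 < a1) :
    -κ0 * a1 ^ 2 - (κ0 + μ) * a1 - μ < 0 := by
  have : -κ0 * a1 ^ 2 - (κ0 + μ) * a1 - μ = -((κ0 * a1 + μ) * (a1 + 1)) := by ring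
  rw [this]; have := mul_pos (by positivity : 0 < κ0 * a1 + μ) (by positivity : 0 < a1 + 1); linarith

/-- AP(2,3): the 1-st Bernstein coefficient of `T/(a₁²u)` on [0,1] (degree 11) is
`−(4/11 + κ₀ + (4/11)κ₀μ)a₁² − (4/11 + (4/11)ν + μ + κ₀ + (8/11)κ₀μ)a₁ − ((4/11)ν + μ + (4/11)κ₀μ) < 0`. -/
theorem bern1_neg {κ0 μ ν a1 : ℝ} (hκ : 0 < κ0) (hμ : 0 < μ) (hν : 0 < ν) (ha : 0 < a1) :
    -(4/11 + κ0 + 4/11 * κ0 * μ) * a1 ^ 2 - (4/11 + 4/11 * ν + μ + κ0 + 8/11 * κ0 * μ) * a1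
      - (4/11 * ν + μ + 4/11 * κ0 * μ) < 0 := by
  have h1 : 0 < (4/11 + κ0 + 4/11 * κ0 * μ) * a1 ^ 2 := by positivity
  have h2 : 0 < (4/11 + 4/11 * ν + μ + κ0 + 8/11 * κ0 * μ) * a1 := by positivity
  have h3 : 0 < 4/11 * ν + μ + 4/11 * κ0 * μ := by positivity
  linarith


/-! ## §7  The Descartes edge (§25.8(ii)) is a Literature fact in the tree

`Literature.Algebra.Polynomial.Descartes.countP_roots_Ioo_le_signVariations_dtest` [Basu–Pollack–Roy 2006, Prop. 10.32]: the number of roots of `T` in `(0,1)`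
is at most `Var(dtest T)`, `dtest T = taylor 1 T.reverse` (its coefficients are the Bernstein coefficients of `T` on `[0,1]` times positive binomials).  Read with the
carrier of §6 on the normalised interval `[0, u(η₂)] = [0,1]`: `Var ≤ 2` ⟹ at most two zeros of `H″` below `η₂` ⟹ at most one island meets `(0, η₂)` (H⁺(2) for that design). -/

open Polynomial in
theorem zeros_below_eta2_le_of_var {T : ℝ[X]} {n : ℕ}
    (h : (Literature.Algebra.Polynomial.Descartes.dtest T).signVariations ≤ n) :
    T.roots.countP (fun x => 0 < x ∧ x < 1) ≤ n :=
  (Literature.Algebra.Polynomial.Descartes.countP_roots_Ioo_le_signVariations_dtest T).trans h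


/-! ## §8  The BINOMIAL FACE ν = 0 and its two dust corners (§25.11)

On the face `ν = 0` the follower is the binomial `Q = a + c·u` on the atoms {0,1} (`c = a₁μ`), `Q₁ = Q₂ = c·u`, and the carrier factors as
`T = u·F`, `F = u·P·Q·L² − (P+Q)(w₀Q³ + a c P³)`, `L = aκ − c + 2a u + c u²`, `w₀ = κ + 4u + κu²` (degree 8 in `u`, three parameters).
Corner `c = 0` (dust at atom 0 = the toy of §25.8(iv) with b = 2a): `T = a³·(−κ(1+a)u − 4(1+a)u² + (κ³ − κ(2+a))u³ + 4κ²u⁴ + 7κu⁵ + 4u⁶)` — one sign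
variation ⟹ at most one zero of ψ on (0,∞).  Corner `a = 0` (dust at the MIDDLE atom): `T = c³u³·(1 − (κ²+cκ+5)u² − (8κ+4c)u³ − (κ²+cκ+5)u⁴ + u⁶)` — two sign
variations, value 1 at u = 0 and a negative value at u = 1 (`Tmid_one_neg`) ⟹ exactly one zero in (0,1) and one in (1,∞): one island `(0, u*)` below η₂. -/

theorem T_face (κ a c u : ℝ) :
    (1 + κ*u + u^2) * (a + c*u) * ((κ*u + 2*u^2) * (a + c*u) - (1 + κ*u + u^2) * (c*u)) ^ 2
      - ((1 + κ*u + u^2) * (κ*u + 4*u^2) - (κ*u + 2*u^2) ^ 2) * ((1 + κ*u + u^2) + (a + c*u)) * (a + c*u) ^ 3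
      - ((a + c*u) * (c*u) - (c*u) ^ 2) * ((1 + κ*u + u^2) + (a + c*u)) * (1 + κ*u + u^2) ^ 3
    = u * ( u * (1 + κ*u + u^2) * (a + c*u) * (a*κ - c + 2*a*u + c*u^2) ^ 2
            - ((1 + κ*u + u^2) + (a + c*u)) * ((κ + 4*u + κ*u^2) * (a + c*u) ^ 3 + a * c * (1 + κ*u + u^2) ^ 3) ) := by
  ring

/-- Corner `c = 0` of the face (constant follower): the toy carrier with `b = 2a`, one sign variation. -/
theorem T_corner_const (κ a u : ℝ) :
    (1 + κ*u + u^2) * a * ((κ*u + 2*u^2) * a - (1 + κ*u + u^2) * 0) ^ 2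
      - ((1 + κ*u + u^2) * (κ*u + 4*u^2) - (κ*u + 2*u^2) ^ 2) * ((1 + κ*u + u^2) + a) * a ^ 3
      - (a * 0 - (0:ℝ) ^ 2) * ((1 + κ*u + u^2) + a) * (1 + κ*u + u^2) ^ 3
    = a^3 * ( -κ*(1+a)*u - 4*(1+a)*u^2 + (κ^3 - κ*(2+a))*u^3 + 4*κ^2*u^4 + 7*κ*u^5 + 4*u^6 ) := by
  ring

/-- Corner `a = 0` of the face (monomial follower at the middle atom): two sign variations. -/
theorem T_corner_mid (κ c u : ℝ) :
    (1 + κ*u + u^2) * (c*u) * ((κ*u + 2*u^2) * (c*u) - (1 + κ*u + u^2) * (c*u)) ^ 2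
      - ((1 + κ*u + u^2) * (κ*u + 4*u^2) - (κ*u + 2*u^2) ^ 2) * ((1 + κ*u + u^2) + c*u) * (c*u) ^ 3
      - ((c*u) * (c*u) - (c*u) ^ 2) * ((1 + κ*u + u^2) + c*u) * (1 + κ*u + u^2) ^ 3
    = c^3 * u^3 * ( 1 - (κ^2 + c*κ + 5)*u^2 - (8*κ + 4*c)*u^3 - (κ^2 + c*κ + 5)*u^4 + u^6 ) := by
  ring

/-- At `u = 1` (= η₂) the middle-atom corner polynomial is negative (it is `1` at `u = 0`): with Descartes' two variations, exactly one zero in (0,1). -/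
theorem Tmid_one_neg {κ c : ℝ} (hκ : 0 ≤ κ) (hc : 0 ≤ c) :
    1 - (κ^2 + c*κ + 5)*1^2 - (8*κ + 4*c)*1^3 - (κ^2 + c*κ + 5)*1^4 + 1^6 < 0 := by
  nlinarith [mul_nonneg hc hκ, sq_nonneg κ]

end Summit.ValiantsHypothesis.ValiantsHypothesis.Cruxes.MatrixDescartes.NegSquaresViolator
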